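import Mathlib
import Summits.Ventures.PercRepro2.SwOutMixedCoreMoveUP
import Summits.Ventures.PercRepro2.SwOutMixedArmsBaseDual

/-!
# The several-arms base: raising the u–p classes keeps the conditioning (blind cell PercRepro2,
night-4 g20, 2026-08-27; proofs/NIGHT4-G20.md §4″, the move M5)

The u–p_r classes are the only MONOCHROMATIC classes of a several-arms base (their base colour is
red, `u_red`), so raising `uP` — any set of arms, the other coordinates fixed — only turns edges
red: `mixedRealR σ q ≤ mixedRealR σ q'` (`mixedRealR_le_of_uP_le`).  Then the red cluster of `l`
grows and its blue cluster shrinks, so `o ∈ C_R(l)`, `o ∉ C_B(l)` and `h ∉ C_B(l)` carry over,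
and `h ∉ C_R(l)` at the new point is the red hull formula there (`cluster_mixedRealR`: the red
cluster of `h` stays inside the region, which does not contain `l`) — provided the new point has
no red-side leak (`mem_tgtU_of_uP_le`).  No assumption on `s`: the move is valid at mixed and at
unmixed `s` alike.  This is the direction OPPOSITE to lowerness; together with the raw-lower moves
with `uP` fixed and at mixed `s` (`mem_tgtU_of_le`) and G5 (`mem_tgtU_toggleXR`) it is the closure
the pulled-back conditioning does satisfy (the census of §4″ finds it sufficient for pure arms).
-/

namespace Summit.Ventures.PercRepro2

namespace MixedArms

open Hull LocRows BigBlock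

variable {V : Type*} {E : Type*}

open scoped Classical

section Raise

variable {ends : E → Sym2 V} {σ : Config E} {h u : V} {ι ρ ν κ : Type*} {U : ι → Set V}
  {p : ρ → V} {Ah : ν → Set V} {arm : ν → ρ} {F : κ → Set V}
  (hb : MixedBaseR ends σ h u U p Ah arm F)
include hb

/-- **Raising `uP` only turns edges red**: for `q'` with the same `s`, `a`, `e`, `f` and
`q.uP ≤ q'.uP`, `mixedRealR σ q ≤ mixedRealR σ q'`. -/
theorem MixedBaseR.mixedRealR_le_of_uP_le {q q' : PtR ι ρ ν κ} (h1 : q'.1 = q.1)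
    (h2 : q'.2.1 = q.2.1) (h3 : q.2.2.1 ≤ q'.2.2.1) (h4 : q'.2.2.2.1 = q.2.2.2.1)
    (h5 : q'.2.2.2.2 = q.2.2.2.2) :
    mixedRealR ends u U p Ah F σ q ≤ mixedRealR ends u U p Ah F σ q' := by
  intro e
  by_cases hUP : ∃ r, e ∈ clsUPR ends u p r
  · obtain ⟨r, hr⟩ := hUP
    rw [hb.mixedRealR_apply_UP hr, hb.mixedRealR_apply_UP hr, hb.u_red e (p r) hr]
    have := h3 r
    revert this
    cases q.2.2.1 r <;> cases q'.2.2.1 r <;> simp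
  · -- off the u–p classes the two realisations agree
    have key : e ∈ flipSetR ends u U p Ah F q' ↔ e ∈ flipSetR ends u U p Ah F q := by
      simp only [flipSetR, Set.mem_union, Set.mem_setOf_eq, h1, h2, h4, h5]
      have hno : ∀ r, ¬ (e ∈ clsUPR ends u p r) := fun r hr => hUP ⟨r, hr⟩
      simp only [hno, and_false, exists_false, or_false]
    unfold mixedRealR
    by_cases hf : e ∈ flipSetR ends u U p Ah F q
    · rw [if_pos (key.2 hf), if_pos hf]
    · rw [if_neg (fun h' => hf (key.1 h')), if_neg hf]

omit hb in
/-- The blue colourings reverse the order. -/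
lemma blue_le_blue_of_le {ω ω' : Config E} (hle : ω ≤ ω') : blue ω' ≤ blue ω := by
  intro e
  have := hle e
  revert this
  simp only [blue]
  cases ω e <;> cases ω' e <;> simp

/-- **Raising `uP` keeps the conditioning** (the move M5): for `q'` with the same `s`, `a`, `e`,
`f`, `q.uP ≤ q'.uP` and no red-side leak at `q'`, the conditioning at `q` gives it at `q'`. -/
theorem MixedBaseR.mem_tgtU_of_uP_le [Fintype E] [DecidableEq E]
    (hup : ∀ r, ∃ e, ends e = s(u, p r)) {Us : Set V} {l o : V}
    (hUs : {h} ∪ {u} ∪ Set.range p ∪ armsAllR U Ah F ⊆ Us) (hl : l ∉ Us)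
    {q q' : PtR ι ρ ν κ} (h1 : q'.1 = q.1) (h2 : q'.2.1 = q.2.1) (h3 : q.2.2.1 ≤ q'.2.2.1)
    (h4 : q'.2.2.2.1 = q.2.2.2.1) (h5 : q'.2.2.2.2 = q.2.2.2.2) (hR' : ¬ LeakRR arm q')
    (hQ : mixedRealR ends u U p Ah F σ q ∈ tgtU ends l h {S : Set V | o ∈ S}) :
    mixedRealR ends u U p Ah F σ q' ∈ tgtU ends l h {S : Set V | o ∈ S} := by
  have hle := hb.mixedRealR_le_of_uP_le h1 h2 h3 h4 h5
  rw [mem_tgtU_iff'] at hQ ⊢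
  obtain ⟨⟨_, hhB⟩, hoR, hoB⟩ := hQ
  refine ⟨⟨fun hh => ?_, fun hh => hhB (conn_mono (blue_le_blue_of_le hle) hh)⟩,
    conn_mono hle hoR, fun ho => hoB (conn_mono (blue_le_blue_of_le hle) ho)⟩
  -- `h ∈ C_R(l)` would put `l` in the red cluster of `h`, which lies in the region
  have hl' : l ∈ cluster ends (mixedRealR ends u U p Ah F σ q') h := conn_symm hh
  rw [hb.cluster_mixedRealR hup hR'] at hl'
  exact hl (hUs (redSetR_subset hl'))

end Raise

end MixedArms

end Summit.Ventures.PercRepro2
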